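import Literature.Analysis.FluidPDE.FluidComputer.TubeTable
import HarnessLib

/-!
# Kernel run of the tube checker, chunks 36 … 41 (steps 1800 … 2099) (bp3 gen 13)

HONEST FRAMING: low prior, high value-of-information experiment on Tao's machine paradigm; NOT a
claim that NS blows up.

Kernel evaluations (`decide +kernel`; no `native_decide`, no extra axioms) of the tube checker
`runTube` of `TubeCheck.lean` (dyadic interval arithmetic `DI` at `P = 60`, `12` Taylor terms,
cube radius `Rt`, read-out level `CLt`) on the chunks `cT 36 … cT 41` of the schedule of
`TubeTable.lean`, each from the recorded boundary state `sT i` to `sT (i+1)` (≈ 0.6 s of kernel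
time per step).
-/

namespace Literature.Analysis.FluidPDE.FluidComputer

namespace TubeTable

open ThresholdLevelTable

set_option maxHeartbeats 10000000 in
set_option maxRecDepth 200000 in
/-- Chunk 36 of the tube run (steps 1800 … 1849, `h = 2^-11`). [folklore] -/
theorem run_36 : runTube 60 12 GIt CLt Rt (sT 36) (cT 36) = some (sT (36 + 1)) := by
  decide +kernel

set_option maxHeartbeats 10000000 in
set_option maxRecDepth 200000 in
/-- Chunk 37 of the tube run (steps 1850 … 1899, `h = 2^-11`). [folklore] -/
theorem run_37 : runTube 60 12 GIt CLt Rt (sT 37) (cT 37) = some (sT (37 + 1)) := by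
  decide +kernel

set_option maxHeartbeats 10000000 in
set_option maxRecDepth 200000 in
/-- Chunk 38 of the tube run (steps 1900 … 1949, `h = 2^-11`). [folklore] -/
theorem run_38 : runTube 60 12 GIt CLt Rt (sT 38) (cT 38) = some (sT (38 + 1)) := by
  decide +kernel

set_option maxHeartbeats 10000000 in
set_option maxRecDepth 200000 in
/-- Chunk 39 of the tube run (steps 1950 … 1999, `h = 2^-11`). [folklore] -/
theorem run_39 : runTube 60 12 GIt CLt Rt (sT 39) (cT 39) = some (sT (39 + 1)) := by
  decide +kernel

set_option maxHeartbeats 10000000 in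
set_option maxRecDepth 200000 in
/-- Chunk 40 of the tube run (steps 2000 … 2049, `h = 2^-11`). [folklore] -/
theorem run_40 : runTube 60 12 GIt CLt Rt (sT 40) (cT 40) = some (sT (40 + 1)) := by
  decide +kernel

set_option maxHeartbeats 10000000 in
set_option maxRecDepth 200000 in
/-- Chunk 41 of the tube run (steps 2050 … 2099, `h = 2^-11`). [folklore] -/
theorem run_41 : runTube 60 12 GIt CLt Rt (sT 41) (cT 41) = some (sT (41 + 1)) := by
  decide +kernel

end TubeTable

end Literature.Analysis.FluidPDE.FluidComputer
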